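import Literature.Computability.Complexity.CircuitEval
import Literature.Computability.Complexity.CookReducibilityTransitive
import Literature.Computability.Complexity.UnaryLeBinary
import HarnessLib

/-!
# Kannan's diagonal language: circuit lower bound and membership in `Σ₄ᵖ` (trunk CplxCore; pnp.S16)

Kannan 1982, Lemma 1 (Inform. Control 55, p. 43): "for each integer `k`, there is a language `L_k`
in `Σ₄ ∩ Π₄` such that `L_k` does not have circuits of size `O(n^k)`". The language is accepted by
a `Σ₄` machine which, on inputs of length `n`, (1) guesses the encoding of a circuit `C*`,
(2)–(3) checks that `C*` differs from every circuit of size `≤ n^{k+1}` on some input, (4)–(6)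
checks that `C*` is the *least* such encoding ("choose the minimum `C*` with the necessary
property", so that the same `C*` is simulated on all inputs of length `n`), and (7) accepts iff
`C*` accepts the input; hardness of some `C*` is the counting Lemma 0 (p. 43, Shannon's argument).
Together with Theorem 1 of the paper (Karp–Lipton–Sipser) this gives Theorem 2, the named fact
`Literature.Computability.Complexity.kannan` (`StructuralPH.lean`), by the two-case argument proved in
`StructuralPHProofs.lean` (`Literature.Computability.Complexity.kannan_of_karp_lipton`, which consumes only the `Σ₄ᵖ` half of
Lemma 1).

This file DEFINES the diagonal language over the prelude's circuit model and PROVES the `Σ₄ᵖ`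
half of Lemma 1 for it, sorry-free:

* `Kannan.lang_not_mem_SIZE`: for every `c`, `L_k ∉ SIZE(c·n^k + c)`;
* `Kannan.lang_mem_SigmaP_four`: `L_k ∈ Σ₄ᵖ`;
* `Kannan.exists_mem_SigmaP_four_not_mem_SIZE`: `∀ k, ∃ L ∈ Σ₄ᵖ, L ∉ ⋃_c SIZE(c·n^k + c)` — the
  hypothesis `h₄` of `Literature.Computability.Complexity.kannan_of_karp_lipton`, so that `Literature.Computability.Complexity.kannan` now rests on the
  Karp–Lipton theorem (`Literature.Computability.Complexity.karp_lipton`) alone.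

## The language (`Kannan.lang`)

Design, with the deviations from the printed machine (all inessential to the cited argument):

* The guessed object is a *truth table* `T` of length `m + 1`, `m = n^{2k+2}` (`Kannan.bound`),
  rather than a circuit `C*` of size `n^{2k+5}` (Kannan needs `C*` to be a circuit only to place
  `L_k` in a fixed polynomial size class, which Theorem 2 does not use).
* The circuits diagonalised against are *all bit strings `D` of length `≤ m`*, read as circuit
  descriptions by the polynomial-time evaluator `CircEval.evalFn` of `CircuitEval.lean`
  (`Kannan.descAccepts`; Kannan p. 41: "every circuit `C` of size `s(C)` can be encoded into a 0,1
  string `e(C)` of length at most `k₀ s(C)^k`", p. 44: "given the encoding of a circuit and an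
  input to the circuit we can, in polynomial-time, find the action of the circuit on the input").
  Every `B₂`-circuit of size `s` on `n` inputs has such a description of length
  `≤ (s+1)(8(n+s)+10)` (`CircEval.length_desc_le`), which is `≤ m` for `s ≤ c·n^k + c` and `n`
  large, so every small circuit is covered.
* The live inputs are the strings `y 0^{n-|y|}` (`Kannan.pad`) with `bitsToNat y ≤ m` (Kannan's
  polynomially many strings `x₁, …, x_{n^{2k+1}}`, cf. his Lemma 2), the table being read at the
  little-endian value `bitsToNat y`, so that `y` and `y0` address the same entry as they pad to the
  same input; "least" is least value `bitsToNat T` among hard tables of length `m + 1`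
  (`Kannan.IsHard`, `Kannan.IsMinHard`); `x ∈ L_k` iff the least hard table at length `|x|` has
  entry `1` at address `bitsToNat x` (empty slice if no table is hard, which happens only at
  finitely many lengths).

## The lower bound (`Kannan.lang_not_mem_SIZE`)

* `Kannan.exists_isHard` — the counting lemma (Kannan's Lemma 0 in this setting): if
  `m + 1 ≤ 2^n` some table of length `m + 1` is hard (pigeonhole: were every table `ofFn f` matched
  on all live inputs by a description `D(f)` of length `≤ m`, then `f ↦ code (D f)` — padding code
  `D 1 0^{m-|D|}` — would be an injective self-map of `Fin (m+1) → Bool`, two tables with the same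
  description agreeing at every address `i ≤ m < 2^n` via `y = bitsOf n i`; hence surjective, but
  no code is all-zero).
* `Kannan.isMinHard_unique`, `Kannan.mem_lang_iff` — the least hard table `T*` is unique and the
  slice of `L_k` is `{x : T*[bitsToNat x] = 1}`.
* `Kannan.not_decides_of_good_length`, `Kannan.exists_good_length` — at a length `n` with
  `(c n^k + c + 1)(8(n + c n^k + c) + 10) ≤ m` and `m + 1 ≤ 2^n` (e.g. `n = 2^{2a+1}`,
  `a = (2c+1)(16c+18) + 2k + 2`) the description of the `n`-th circuit of a deciding family of size
  `≤ c·n^k + c` is diagonalised against, contradicting hardness of `T*` ("for each `n` sufficiently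
  large, `L_k ∩ {0,1}^n` cannot be accepted by a circuit of size `n^{k+1}` or less", p. 44).

## Membership in `Σ₄ᵖ` (`Kannan.lang_mem_SigmaP_four`)

`Σ₄ᵖ = ∃ᵖ·∀ᵖ·∃ᵖ·∀ᵖ·P` in the prelude (`PolyHierarchy.lean`: `sigmaP`, `polyExists`,
`polyForall`). We exhibit the sentence (`Kannan.A4 ⊇ A3 ⊇ A2 ⊇ A1 ⊇ A0`)

  `x ∈ L_k ⇔ ∃ t = ⟨T, j⟩ ∀ v = ⟨D, T'⟩ ∃ u = ⟨⟨y, j_y⟩, D'⟩ ∀ z = ⟨⟨y', j_{y'}⟩, i⟩ : Matrix`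

(witness bounds `Kannan.p1 … p4`), whose matrix (`Kannan.MatrixPred`) says: `|T| = m + 1`;
`|j| = bitsToNat x` and `T[|j|] = 1` (step (7)); if `|D| ≤ m` then `y` is live, `|j_y| = bitsToNat y`
and the circuit described by `D` disagrees with `T[|j_y|]` on `y0^{n-|y|}` (steps (2)–(3)); if
`|T'| = m + 1` and position `|i|` witnesses `bitsToNat T' < bitsToNat T` (a `0` of `T'` against a `1`
of `T` with equal bits above, `Kannan.bitsToNat_lt_iff` — Kannan's "`e(C) < e(C*)` as binary
integers") then `|D'| ≤ m` and the circuit described by `D'` agrees with `T'` on every live `y'`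
with `|j_{y'}| = bitsToNat y'` (steps (4)–(6): a smaller table is not hard). Binary addresses carry
unary companions (`j`, `j_y`, `j_{y'}`) checked by the unary/binary threshold test of
`UnaryLeBinary.lean` (`Kannan.unLeBinFn_boolPair_bits`, its specification on arbitrary bit
strings), so that table look-ups are suffix reads (`dropSndFn`); the comparison position `i` sits in
the last universal block by the prenex rule `(∀i ¬W i) ∨ (∃D' ∀y' Φ) ≡ ∃D' ∀y' ∀i (W i → Φ)`.
The matrix is in `P` (`Kannan.A0_mem_P`) as a Boolean combination of polynomial-time tests on
projected components, all from the library: pair projections and fan-out (`PRelHierarchy`),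
`LenLe/LenEq` (`LengthCompare`), `EqPair` (`StringEquality`), `HeadIs` (`PRelHierarchy`), `dropSndFn`
(`CoinTruncation`), `concatFn` (`CookReducibilityTransitive`), `unLeBinFn` (`UnaryLeBinary`), the
circuit evaluator `evalFn` (`CircuitEval`), closure of `P` under `∩, ∪, ᶜ` and `FP`-preimages.
Completeness (`Kannan.lang_subset_A4`) answers the challenge `⟨D, T'⟩` with the disagreement input of
`D` (hardness of `T*`) and a description matching `T'` (minimality of `T*`); soundness
(`Kannan.A4_subset_lang`) challenges a surviving `⟨T, j⟩` with `⟨D, ε⟩` (hardness) and, for a smaller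
hard competitor `T'`, with `⟨ε, T'⟩` followed by the witness position of `T' < T` and the disagreement
input of `T'` against the answered `D'` (minimality).

The `Π₄ᵖ` half of Lemma 1 (Kannan: "the complement of `L_k` is accepted by a `Σ₄` machine whose
description is the same except now step (7) reads `C*` rejects `x`" — correct at the cofinitely
many lengths where a hard table exists) is not needed for Theorem 2 and is not formalised here.

## References

* R. Kannan, *Circuit-size lower bounds and non-reducibility to sparse sets*, Inform. Control 55
  (1982) 40–56: Lemma 0 (p. 43), Lemma 1 and its proof (pp. 43–44), Lemma 2 (p. 45), Thm. 2
  (p. 44). doi:10.1016/S0019-9958(82)90382-5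
* S. Arora, B. Barak, *Computational Complexity: A Modern Approach*, CUP 2009, Def. 5.3 (`Σₖᵖ` by
  alternating polynomially bounded quantifiers), Thm. 6.18 (circuit evaluation in `P`), Thm. 6.21
  and Exercises 6.5–6.6 (counting; `PH ⊄ SIZE(n^k)`), §1.3 (polynomial-time string primitives).
* S. Jukna, *Boolean Function Complexity*, Springer 2012, Thm. 20.13 (Kannan's theorem).
-/

namespace Literature.Computability.Complexity

namespace Kannan

open CircEval

/-! ### Little-endian addressing -/

/-- The `n`-bit little-endian binary representation of `i` (value `i mod 2^n`). [folklore] -/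
def bitsOf : ℕ → ℕ → List Bool
  | 0, _ => []
  | n + 1, i => decide (i % 2 = 1) :: bitsOf n (i / 2)

/-- `bitsOf n i` has length `n`. [folklore] -/
@[simp] theorem length_bitsOf : ∀ n i : ℕ, (bitsOf n i).length = n
  | 0, _ => rfl
  | n + 1, i => by simp [bitsOf, length_bitsOf n]

/-- `bitsOf n i` has value `i` for `i < 2^n`. [folklore] -/
theorem bitsToNat_bitsOf : ∀ (n i : ℕ), i < 2 ^ n → bitsToNat (bitsOf n i) = i
  | 0, i, h => by simp at h; simp [bitsOf, h]
  | n + 1, i, h => by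
    have ih := bitsToNat_bitsOf n (i / 2) (by omega)
    simp only [bitsOf, bitsToNat_cons, ih]
    rcases Nat.mod_two_eq_zero_or_one i with h0 | h1
    · simp [h0]; omega
    · simp [h1]; omega

/-- Strings of equal length with equal little-endian value are equal. [folklore] -/
theorem eq_of_bitsToNat_eq : ∀ {v w : List Bool}, v.length = w.length → bitsToNat v = bitsToNat w → v = w
  | [], [], _, _ => rfl
  | [], _ :: _, h, _ => by simp at h
  | _ :: _, [], h, _ => by simp at h
  | a :: v, b :: w, h, hv => by
    simp only [List.length_cons, Nat.add_right_cancel_iff] at h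
    simp only [bitsToNat_cons] at hv
    have hab : a = b := by
      cases a <;> cases b <;> simp at hv ⊢ <;> omega
    subst hab
    have : bitsToNat v = bitsToNat w := by omega
    rw [eq_of_bitsToNat_eq h this]

/-! ### Descriptions, padding, parameters -/

/-- **Acceptance by a description string**: the bit string `D`, read as the description of a
circuit by the evaluator of `CircuitEval.lean`, accepts the input `z`, i.e. `evalFn ⟨z, D⟩ = [1]`.
Total in `D` (every string is a "description"); for `D = desc C` it is `C(z)` (`descAccepts_desc`).
[Kannan 1982, p. 41 ("every circuit `C` can be encoded into a 0,1 string `e(C)`"), p. 44 ("given the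
encoding of a circuit and an input we can, in polynomial-time, find the action of the circuit")]
[cite: Kannan1982, Lemma 1 (proof)] -/
def descAccepts (D z : List Bool) : Bool :=
  decide (evalFn (boolPair z D) = [true])

/-- On a genuine description, `descAccepts` is the value of the circuit.
[Arora–Barak 2009, Thm. 6.18 (proof)] [cite: AroraBarakCC2009, Thm. 6.18] -/
theorem descAccepts_desc (z : List Bool) (C : Circuit (Fin z.length)) (hC : C.IsOver B2) :
    descAccepts (desc C) z = C.eval z.get := by
  rw [descAccepts, evalFn_boolPair_desc z C fun g hg => hC g hg]
  cases C.eval z.get <;> simp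

/-- Padding with high-order zeros to length `n`: `pad n y = y 0^{n-|y|}`. [Kannan 1982, Lemma 2
(the strings `x_j 0`)] [cite: Kannan1982, Lemma 2] -/
def pad (n : ℕ) (y : List Bool) : List Bool :=
  y ++ List.replicate (n - y.length) false

/-- `|pad n y| = n` for `|y| ≤ n`. [folklore] -/
theorem length_pad {n : ℕ} {y : List Bool} (h : y.length ≤ n) : (pad n y).length = n := by
  simp [pad]; omega

/-- Padding does not change the value. [folklore] -/
@[simp] theorem bitsToNat_pad (n : ℕ) (y : List Bool) : bitsToNat (pad n y) = bitsToNat y := by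
  simp [pad, bitsToNat_append]

/-- The description-length budget `m(n) = n^{2k+2}` diagonalised against at input length `n`
(Kannan uses size `n^{k+1}`; any budget eventually exceeding the description length of circuits of
size `c·n^k + c` for every `c` serves). [Kannan 1982, Lemma 1 (proof, steps (2), (5))]
[cite: Kannan1982, Lemma 1 (proof)] -/
def bound (k n : ℕ) : ℕ :=
  n ^ (2 * k + 2)

/-! ### Hard tables and the language -/

/-- **`T` is a hard table at length `n`**: `T` has length `n^{2k+2} + 1` and every description `D`
of length `≤ n^{2k+2}` errs on some live input, i.e. for some `y` with `|y| ≤ n` and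
`bitsToNat y ≤ n^{2k+2}`, the circuit described by `D` on `y0^{n-|y|}` disagrees with the table
entry `T[bitsToNat y]`. Kannan's steps (1)–(3): "`∃ e(C*)` … `∀ e(C')` of circuits of size at most
`n^{k+1}` `∃` a string `y` such that `C*` and `C'` differ on `y`". [cite: Kannan1982, Lemma 1 (proof, steps (1)–(3))] -/
def IsHard (k n : ℕ) (T : List Bool) : Prop :=
  T.length = bound k n + 1 ∧
    ∀ D : List Bool, D.length ≤ bound k n →
      ∃ y : List Bool, y.length ≤ n ∧ bitsToNat y ≤ bound k n ∧
        descAccepts D (pad n y) ≠ T.getD (bitsToNat y) false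

/-- **`T` is the least hard table at length `n`**: hard, and no hard table of the same length has
smaller value. Kannan's steps (4)–(6): "`∀` encodings `e(C) < e(C*)` (as binary integers) `∃ e(C₀)`
of a circuit of size at most `n^{k+1}` such that `∀` strings `z` of length `n`, `C₀` agrees with
`C`" — i.e. no smaller candidate is hard. [cite: Kannan1982, Lemma 1 (proof, steps (4)–(6))] -/
def IsMinHard (k n : ℕ) (T : List Bool) : Prop :=
  IsHard k n T ∧ ∀ T' : List Bool, T'.length = bound k n + 1 → bitsToNat T' < bitsToNat T → ¬ IsHard k n T'

/-- **Kannan's diagonal language `L_k`**: `x ∈ L_k` iff the least hard table at length `|x|` has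
entry `1` at address `bitsToNat x` (step (7): "and `C*` accepts `x`"). At lengths where no table is
hard the slice is empty. [cite: Kannan1982, Lemma 1] -/
def lang (k : ℕ) : Language Bool :=
  {x | ∃ T : List Bool, IsMinHard k x.length T ∧ T.getD (bitsToNat x) false = true}

/-- Unfolding membership in `lang k`. [cite: Kannan1982, Lemma 1] -/
theorem mem_lang {k : ℕ} {x : List Bool} :
    x ∈ lang k ↔ ∃ T : List Bool, IsMinHard k x.length T ∧ T.getD (bitsToNat x) false = true :=
  Iff.rfl

/-! ### Uniqueness and existence of the least hard table -/

/-- Two least hard tables at the same length coincide (values are comparable, and equal values of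
equal-length strings force equality). [cite: Kannan1982, Lemma 1 (proof: "choose the minimum C*")] -/
theorem isMinHard_unique {k n : ℕ} {T₁ T₂ : List Bool} (h₁ : IsMinHard k n T₁) (h₂ : IsMinHard k n T₂) :
    T₁ = T₂ := by
  rcases lt_trichotomy (bitsToNat T₁) (bitsToNat T₂) with h | h | h
  · exact absurd h₁.1 (h₂.2 T₁ h₁.1.1 h)
  · exact eq_of_bitsToNat_eq (h₁.1.1.trans h₂.1.1.symm) h
  · exact absurd h₂.1 (h₁.2 T₂ h₂.1.1 h)

/-- If some table is hard, a least hard table exists (least value). [cite: Kannan1982, Lemma 1 (proof)] -/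
theorem exists_isMinHard {k n : ℕ} (h : ∃ T, IsHard k n T) : ∃ T, IsMinHard k n T := by
  classical
  have hP : ∃ v : ℕ, ∃ T, IsHard k n T ∧ bitsToNat T = v := by
    obtain ⟨T, hT⟩ := h
    exact ⟨_, T, hT, rfl⟩
  obtain ⟨T, hT, hv⟩ := Nat.find_spec hP
  refine ⟨T, hT, fun T' _ hlt hT' => ?_⟩
  exact Nat.find_min hP (hv ▸ hlt) ⟨T', hT', rfl⟩

/-- **The slice of `L_k` at a length with a least hard table `T`** is read off `T`:
`x ∈ L_k ↔ T[bitsToNat x] = 1`. [cite: Kannan1982, Lemma 1 (proof)] -/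
theorem mem_lang_iff {k : ℕ} {x : List Bool} {T : List Bool} (hT : IsMinHard k x.length T) :
    x ∈ lang k ↔ T.getD (bitsToNat x) false = true := by
  refine ⟨?_, fun h => ⟨T, hT, h⟩⟩
  rintro ⟨T', hT', h⟩
  rwa [isMinHard_unique hT' hT] at h

/-! ### The counting lemma (Kannan's Lemma 0 for descriptions) -/

/-- Padding code of a string of length `≤ m` into `m + 1` bits: `D 1 0^{m-|D|}`; injective on such
strings (`code_injective`) and never all-zero. [folklore] -/
def code (m : ℕ) (D : List Bool) : Fin (m + 1) → Bool :=
  fun j => (D ++ true :: List.replicate (m - D.length) false).getD j false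

/-- The list underlying `code m D` has length `m + 1` when `|D| ≤ m`. [folklore] -/
theorem length_code_list {m : ℕ} {D : List Bool} (h : D.length ≤ m) :
    (D ++ true :: List.replicate (m - D.length) false).length = m + 1 := by
  simp; omega

/-- The code has a `1` at position `|D|`. [folklore] -/
theorem code_apply_length {m : ℕ} {D : List Bool} (h : D.length ≤ m) :
    code m D ⟨D.length, Nat.lt_succ_of_le h⟩ = true := by
  simp [code, List.getD_eq_getElem?_getD]

/-- Beyond position `|D|` the code is `0`. [folklore] -/
theorem code_apply_of_lt {m : ℕ} {D : List Bool} (j : Fin (m + 1)) (hj : D.length < j) :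
    code m D j = false := by
  simp only [code, List.getD_eq_getElem?_getD]
  rw [List.getElem?_append_right (by omega)]
  obtain ⟨i, hi⟩ : ∃ i, (j : ℕ) - D.length = i + 1 := ⟨j - D.length - 1, by omega⟩
  rw [hi, List.getElem?_cons_succ]
  by_cases him : i < m - D.length
  · simp [him]
  · rw [List.getElem?_eq_none (by simp; omega)]
    rfl

/-- Below position `|D|` the code reads `D`. [folklore] -/
theorem code_apply_of_gt {m : ℕ} {D : List Bool} (j : Fin (m + 1)) (hj : (j : ℕ) < D.length) :
    code m D j = D[(j : ℕ)] := by
  simp [code, List.getD_eq_getElem?_getD, List.getElem?_append_left hj, List.getElem?_eq_getElem hj]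

/-- **The padding code is injective on strings of length `≤ m`.** [folklore] -/
theorem code_injective {m : ℕ} {D₁ D₂ : List Bool} (h₁ : D₁.length ≤ m) (h₂ : D₂.length ≤ m)
    (h : code m D₁ = code m D₂) : D₁ = D₂ := by
  have hlen : D₁.length = D₂.length := by
    by_contra hne
    rcases Nat.lt_or_gt_of_ne hne with hlt | hlt
    · have e₁ := code_apply_of_lt (m := m) (D := D₁) ⟨D₂.length, Nat.lt_succ_of_le h₂⟩ hlt
      rw [h, code_apply_length h₂] at e₁
      exact Bool.noConfusion e₁
    · have e₂ := code_apply_of_lt (m := m) (D := D₂) ⟨D₁.length, Nat.lt_succ_of_le h₁⟩ hlt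
      rw [← h, code_apply_length h₁] at e₂
      exact Bool.noConfusion e₂
  refine List.ext_getElem hlen fun i hi₁ hi₂ => ?_
  have c₁ := code_apply_of_gt (m := m) (D := D₁) ⟨i, by omega⟩ hi₁
  have c₂ := code_apply_of_gt (m := m) (D := D₂) ⟨i, by omega⟩ hi₂
  rw [← c₁, ← c₂, h]

/-- Reading a table given as `List.ofFn f` at an address `< m`. [folklore] -/
theorem getD_ofFn {m : ℕ} (f : Fin m → Bool) {i : ℕ} (hi : i < m) :
    (List.ofFn f).getD i false = f ⟨i, hi⟩ := by
  simp [List.getD_eq_getElem?_getD, hi]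

/-- **Counting lemma** (Kannan's Lemma 0, description form): if `n^{2k+2} + 1 ≤ 2^n` then some table
of length `n^{2k+2} + 1` is hard at length `n`. Otherwise every table `T = ofFn f` agrees on all
live inputs with some description `D(f)` of length `≤ m = n^{2k+2}`; `f ↦ code (D f)` is an
injective self-map of `Fin (m+1) → Bool` (two tables with the same description agree at every
address `i ≤ m`, addressed by `y = bitsOf n i` since `m + 1 ≤ 2^n`), hence surjective, but no code
is all-zero. (Kannan counts circuits of size `n^k` against subsets of `{x₁, …, x_{n^{2k+1}}}`.)
[cite: Kannan1982, Lemma 0] -/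
theorem exists_isHard (k n : ℕ) (hn : bound k n + 1 ≤ 2 ^ n) : ∃ T, IsHard k n T := by
  classical
  by_contra hno
  push Not at hno
  -- every table of the right length is matched by a short description on all live inputs
  have hmatch : ∀ f : Fin (bound k n + 1) → Bool, ∃ D : List Bool, D.length ≤ bound k n ∧
      ∀ y : List Bool, y.length ≤ n → bitsToNat y ≤ bound k n →
        descAccepts D (pad n y) = (List.ofFn f).getD (bitsToNat y) false := by
    intro f
    have h := hno (List.ofFn f)
    simp only [IsHard, List.length_ofFn, true_and, not_forall, not_exists, not_and, not_not,
      exists_prop] at h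
    obtain ⟨D, hD, hagree⟩ := h
    exact ⟨D, hD, fun y hy hv => hagree y hy hv⟩
  choose D hD hagree using hmatch
  let G : (Fin (bound k n + 1) → Bool) → (Fin (bound k n + 1) → Bool) := fun f => code (bound k n) (D f)
  have hG : Function.Injective G := by
    intro f₁ f₂ hf
    have hDD : D f₁ = D f₂ := code_injective (hD f₁) (hD f₂) hf
    funext ⟨i, hi⟩
    have hi2 : i < 2 ^ n := lt_of_lt_of_le hi hn
    have hy : (bitsOf n i).length ≤ n := by simp
    have hv : bitsToNat (bitsOf n i) ≤ bound k n := by rw [bitsToNat_bitsOf n i hi2]; omega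
    have a₁ := hagree f₁ (bitsOf n i) hy hv
    have a₂ := hagree f₂ (bitsOf n i) hy hv
    rw [bitsToNat_bitsOf n i hi2, getD_ofFn _ hi] at a₁ a₂
    rw [← a₁, ← a₂, hDD]
  obtain ⟨f, hf⟩ := (Finite.injective_iff_surjective.1 hG) fun _ => false
  have h1 : G f ⟨(D f).length, Nat.lt_succ_of_le (hD f)⟩ = true := code_apply_length (hD f)
  rw [hf] at h1
  exact Bool.false_ne_true h1

/-! ### The lower bound -/

/-- Consistency of a deciding family with the least hard table: if the family `C` decides `L_k` and
`T` is the least hard table at length `|z|`, then the description of `C_{|z|}` accepts `z` iff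
`T[bitsToNat z] = 1`. [cite: Kannan1982, Lemma 1 (proof)] -/
theorem descAccepts_desc_eq_getD {k : ℕ} {C : CircuitFamily} (hC : ∀ n, (C n).IsOver B2)
    (hdec : C.Decides (lang k)) (z : List Bool) {T : List Bool} (hT : IsMinHard k z.length T) :
    descAccepts (desc (C z.length)) z = T.getD (bitsToNat z) false := by
  rw [descAccepts_desc z (C z.length) (hC z.length), hdec z]
  by_cases hz : z ∈ lang k
  · rw [(Set.mem_iff_boolIndicator _ _).1 hz, ((mem_lang_iff hT).1 hz)]
  · rw [(Set.notMem_iff_boolIndicator _ _).1 hz]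
    have : ¬ T.getD (bitsToNat z) false = true := fun h => hz ((mem_lang_iff hT).2 h)
    simpa using this

/-- The description-length bound is monotone in the size bound: a `B₂`-circuit of size `≤ s` on `n`
inputs has a description of length `≤ (s+1)(8(n+s)+10)`. [cite: AroraBarakCC2009, Thm. 6.18] -/
theorem length_desc_le_of_size_le {n s : ℕ} (C : Circuit (Fin n)) (hs : C.size ≤ s) :
    (desc C).length ≤ (s + 1) * (8 * (n + s) + 10) :=
  (length_desc_le C).trans (Nat.mul_le_mul (by omega) (by omega))

/-- **A good length defeats every small family.** If at length `n` the descriptions of circuits of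
size `≤ c·n^k + c` fit the budget, `(c n^k + c + 1)(8(n + c n^k + c) + 10) ≤ n^{2k+2}`, and
`n^{2k+2} + 1 ≤ 2^n`, then no `B₂`-family of size `≤ c·n^k + c` decides `L_k`: the description of
its `n`-th circuit is diagonalised against by the least hard table. [cite: Kannan1982, Lemma 1 (proof)] -/
theorem not_decides_of_good_length {k c n : ℕ}
    (hA : (c * n ^ k + c + 1) * (8 * (n + (c * n ^ k + c)) + 10) ≤ bound k n)
    (hB : bound k n + 1 ≤ 2 ^ n) {C : CircuitFamily}
    (hC : ∀ n, (C n).IsOver B2 ∧ (C n).size ≤ c * n ^ k + c) : ¬ C.Decides (lang k) := by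
  intro hdec
  obtain ⟨T, hT⟩ := exists_isMinHard (exists_isHard k n hB)
  have hD : (desc (C n)).length ≤ bound k n :=
    (length_desc_le_of_size_le (C n) (hC n).2).trans hA
  obtain ⟨y, hy, -, hne⟩ := hT.1.2 (desc (C n)) hD
  apply hne
  have hlen : (pad n y).length = n := length_pad hy
  have key := descAccepts_desc_eq_getD (fun n => (hC n).1) hdec (pad n y) (T := T) (by rw [hlen]; exact hT)
  rw [hlen] at key
  rw [key, bitsToNat_pad]

/-- **Good lengths exist**: for all `k, c` there is `n` with
`(c n^k + c + 1)(8(n + c n^k + c) + 10) ≤ n^{2k+2}` and `n^{2k+2} + 1 ≤ 2^n`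
(take `n = 2^{2a+1}` with `a = (2c+1)(16c+18) + 2k + 2`). [folklore] -/
theorem exists_good_length (k c : ℕ) :
    ∃ n : ℕ, (c * n ^ k + c + 1) * (8 * (n + (c * n ^ k + c)) + 10) ≤ bound k n ∧
      bound k n + 1 ≤ 2 ^ n := by
  set K := (2 * c + 1) * (16 * c + 18) with hK
  set d := 2 * k + 2 with hd
  set a := K + d with ha
  refine ⟨2 ^ (2 * a + 1), ?_, ?_⟩
  · -- the polynomial inequality, valid for every `n ≥ K` with `n ≥ 1`
    set n := 2 ^ (2 * a + 1) with hn
    have hn1 : 1 ≤ n := Nat.one_le_two_pow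
    have hnK : K ≤ n := by
      have : a < 2 ^ a := Nat.lt_two_pow_self
      have : 2 ^ a ≤ n := Nat.pow_le_pow_right (by norm_num) (by omega)
      omega
    have hp1 : 1 ≤ n ^ k := Nat.one_le_pow _ _ hn1
    have h1 : c * n ^ k + c + 1 ≤ (2 * c + 1) * n ^ k := by nlinarith
    have h2 : 8 * (n + (c * n ^ k + c)) + 10 ≤ (16 * c + 18) * (n ^ k * n) := by
      have : n ≤ n ^ k * n := by nlinarith
      have : n ^ k ≤ n ^ k * n := by nlinarith
      nlinarith
    calc (c * n ^ k + c + 1) * (8 * (n + (c * n ^ k + c)) + 10)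
        ≤ (2 * c + 1) * n ^ k * ((16 * c + 18) * (n ^ k * n)) :=
          Nat.mul_le_mul h1 h2 |>.trans (by ring_nf; exact le_rfl)
      _ = K * (n ^ k * n ^ k * n) := by rw [hK]; ring
      _ ≤ n * (n ^ k * n ^ k * n) := Nat.mul_le_mul_right _ hnK
      _ = bound k n := by rw [bound, ← hd]; ring
  · -- `n^d < 2^n` at `n = 2^(2a+1)`: `(2a+1)·d < 2^(2a+1)` as `d ≤ a < 2^a` and `2a+1 ≤ 2^(a+1)`
    rw [bound, ← hd, ← pow_mul]
    have ha2 : a < 2 ^ a := Nat.lt_two_pow_self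
    have hda : d ≤ a := by omega
    have h3 : (2 * a + 1) * d < 2 ^ (2 * a + 1) := by
      calc (2 * a + 1) * d ≤ (2 * a + 1) * a := Nat.mul_le_mul_left _ hda
        _ ≤ (2 * a + 1) * 2 ^ a := Nat.mul_le_mul_left _ ha2.le
        _ < 2 ^ (a + 1) * 2 ^ a :=
            Nat.mul_lt_mul_of_pos_right (by rw [pow_succ]; omega) (by positivity)
        _ = 2 ^ (2 * a + 1) := by rw [← pow_add]; ring_nf
    have := Nat.pow_lt_pow_right (by norm_num : 1 < 2) h3
    omega

/-- **Kannan's lower bound for `L_k`**: for every `c`, the diagonal language `L_k` is decided by no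
`B₂`-circuit family of size `≤ c·n^k + c`; hence `L_k ∉ ⋃_c SIZE(c·n^k + c)`, i.e. `L_k` does not
have `O(n^k)`-size circuits. [cite: Kannan1982, Lemma 1] -/
theorem lang_not_mem_SIZE (k c : ℕ) : lang k ∉ SIZE (fun n => c * n ^ k + c) := by
  rintro ⟨C, hC, hdec⟩
  obtain ⟨n, hA, hB⟩ := exists_good_length k c
  exact not_decides_of_good_length hA hB hC hdec

/-- The same for the union over the constants: `L_k ∉ ⋃_c SIZE(c·n^k + c)` (the size bound of
`Literature.Computability.Complexity.kannan`). [cite: Kannan1982, Lemma 1] -/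
theorem lang_not_mem_iUnion_SIZE (k : ℕ) : lang k ∉ ⋃ c : ℕ, SIZE (fun n => c * n ^ k + c) := by
  rw [Set.mem_iUnion]
  rintro ⟨c, hc⟩
  exact lang_not_mem_SIZE k c hc

open _root_.Computability Polynomial PRelSigma OracleCompose

/-! ### Polynomial-time tests (library blocks, specialised) -/

section Blocks

variable {f g : List Bool → List Bool}

/-- The all-zeros transducer: every input symbol becomes `0`. [folklore] -/
def zerosT : FST Unit Bool Bool where
  init := ()
  step := fun _ _ => ((), [false])
  front := fun _ => []
  keep := fun _ => true

/-- `zerosT` outputs `0^{|w|}`. [folklore] -/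
theorem zerosT_eval (w : List Bool) : zerosT.eval w = List.replicate w.length false := by
  have h : ∀ w : List Bool, (zerosT.run () w).2 = List.replicate w.length false := by
    intro w
    induction w with
    | nil => rfl
    | cons b w ih =>
      rw [FST.run_cons, List.length_cons, List.replicate_succ]
      exact congrArg (List.cons false) ih
  have he : zerosT.eval w = zerosT.front (zerosT.run zerosT.init w).1 ++ (zerosT.run zerosT.init w).2 := by
    simp [FST.eval, zerosT]
  rw [he, show zerosT.init = () from rfl, h]
  rfl

/-- The zero string of the same length: `zerosFn w = 0^{|w|}`. [folklore] -/
def zerosFn : List Bool → List Bool := zerosT.eval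

/-- `zerosFn w = 0^{|w|}`. [folklore] -/
@[simp] theorem zerosFn_apply (w : List Bool) : zerosFn w = List.replicate w.length false :=
  zerosT_eval w

/-- `zerosFn ∈ FP`. [folklore] -/
theorem zerosFn_mem_FP : zerosFn ∈ FP := zerosT.polyTimeComputable_eval

/-- **General specification of the unary/binary threshold test** of `UnaryLeBinary.lean`:
`unLeBinFn ⟨u, w⟩ = [|u| ≤ bitsToNat w]` for *every* bit string `w` (not only Mathlib's canonical
numerals `encodeNat v`, the case recorded there as `unLeBinFn_boolPair`): the capped Horner pass
reads all bits. [cite: AroraBarakCC2009, §1.3] -/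
theorem unLeBinFn_boolPair_bits (u w : List Bool) :
    unLeBinFn (boolPair u w) = [decide (u.length ≤ bitsToNat w)] := by
  rw [unLeBinFn, UnLeBin.parseSpec_boolPair, Nat.zero_add]
  have h0 : UnLeBin.Inv u.length 0 (0, u.length) := ⟨by simp, by simp⟩
  have h := UnLeBin.Inv.pass w.reverse h0
  rw [UnLeBin.msbVal_reverse, zero_mul, zero_add] at h
  obtain ⟨h1, h2⟩ := h
  simp only [List.cons.injEq, and_true]
  rw [decide_eq_decide]
  omega

/-- The threshold language `{s | unLeBinFn s = [1]}`; on pairs, `⟨u, w⟩ ∈ UnLe ↔ |u| ≤ bitsToNat w`.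
[cite: AroraBarakCC2009, §1.3] -/
def UnLe : Language Bool :=
  {s | unLeBinFn s = [true]}

/-- Membership of a pair in `UnLe`. [folklore] -/
@[simp] theorem boolPair_mem_UnLe (u w : List Bool) : boolPair u w ∈ UnLe ↔ u.length ≤ bitsToNat w := by
  change unLeBinFn (boolPair u w) = [true] ↔ _
  rw [unLeBinFn_boolPair_bits]
  simp

/-- `UnLe ∈ P`. [cite: AroraBarakCC2009, §1.3] -/
theorem UnLe_mem_P : UnLe ∈ Classes.P :=
  mem_P_of_mem_FP unLeBinFn_mem_FP _ fun s => ⟨fun h => h, fun h => by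
    obtain ⟨b, hb⟩ : ∃ b : Bool, unLeBinFn s = [b] := ⟨_, rfl⟩
    have hne : unLeBinFn s ≠ [true] := h
    rw [hb] at hne ⊢
    cases b
    · rfl
    · exact absurd rfl hne⟩

/-- Length test between two computed strings: `{w | |g w| ≤ p(|f w|)} ∈ P`. [cite: AroraBarakCC2009, §1.3] -/
theorem setOf_length_le_mem_P (hf : f ∈ FP) (hg : g ∈ FP) (p : Polynomial ℕ) :
    ({w | (g w).length ≤ p.eval (f w).length} : Language Bool) ∈ Classes.P := by
  have h : ({w | (g w).length ≤ p.eval (f w).length} : Language Bool) = pairFn f g ⁻¹' LenLe p :=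
    Set.ext fun w => by
      change (g w).length ≤ p.eval (f w).length ↔ pairFn f g w ∈ LenLe p
      rw [pairFn_apply, boolPair_mem_LenLe]
  rw [h]
  exact preimage_mem_P (LenLe_mem_P p) (pairFn_mem_FP hf hg)

/-- Exact length test between two computed strings: `{w | |g w| = p(|f w|)} ∈ P`. [cite: AroraBarakCC2009, §1.3] -/
theorem setOf_length_eq_mem_P (hf : f ∈ FP) (hg : g ∈ FP) (p : Polynomial ℕ) :
    ({w | (g w).length = p.eval (f w).length} : Language Bool) ∈ Classes.P := by
  have h : ({w | (g w).length = p.eval (f w).length} : Language Bool) = pairFn f g ⁻¹' LenEq p :=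
    Set.ext fun w => by
      change (g w).length = p.eval (f w).length ↔ pairFn f g w ∈ LenEq p
      rw [pairFn_apply, boolPair_mem_LenEq]
  rw [h]
  exact preimage_mem_P (LenEq_mem_P p) (pairFn_mem_FP hf hg)

/-- Unary-versus-binary test between two computed strings: `{w | |f w| ≤ bitsToNat (g w)} ∈ P`.
[cite: AroraBarakCC2009, §1.3] -/
theorem setOf_length_le_bitsToNat_mem_P (hf : f ∈ FP) (hg : g ∈ FP) :
    ({w | (f w).length ≤ bitsToNat (g w)} : Language Bool) ∈ Classes.P := by
  have h : ({w | (f w).length ≤ bitsToNat (g w)} : Language Bool) = pairFn f g ⁻¹' UnLe :=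
    Set.ext fun w => by
      change (f w).length ≤ bitsToNat (g w) ↔ pairFn f g w ∈ UnLe
      rw [pairFn_apply, boolPair_mem_UnLe]
  rw [h]
  exact preimage_mem_P UnLe_mem_P (pairFn_mem_FP hf hg)

/-- Unary-equals-binary test: `{w | |f w| = bitsToNat (g w)} ∈ P` (`≤` and not `1 + · ≤`).
[cite: AroraBarakCC2009, §1.3] -/
theorem setOf_length_eq_bitsToNat_mem_P (hf : f ∈ FP) (hg : g ∈ FP) :
    ({w | (f w).length = bitsToNat (g w)} : Language Bool) ∈ Classes.P := by
  have h : ({w | (f w).length = bitsToNat (g w)} : Language Bool) =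
      {w | (f w).length ≤ bitsToNat (g w)} ⊓ {w | ((List.cons true ∘ f) w).length ≤ bitsToNat (g w)}ᶜ := by
    ext w
    simp only [Set.mem_setOf_eq, Set.inf_eq_inter, Set.mem_inter_iff, Set.mem_compl_iff,
      Function.comp_apply, List.length_cons]
    omega
  rw [h]
  exact inter_mem_P (setOf_length_le_bitsToNat_mem_P hf hg)
    (compl_mem_P_iff.2 (setOf_length_le_bitsToNat_mem_P (comp_mem_FP (cons_mem_FP true) hf) hg))

/-- Reading a bit at a unary address: `bitFn f g w = (g w).drop |f w|` (its head is bit `|f w|` of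
`g w`). [folklore] -/
noncomputable def bitFn (f g : List Bool → List Bool) : List Bool → List Bool :=
  sndP ∘ dropSndFn X ∘ pairFn f g

/-- `bitFn f g w = (g w).drop |f w|`. [folklore] -/
@[simp] theorem bitFn_apply (f g : List Bool → List Bool) (w : List Bool) :
    bitFn f g w = (g w).drop (f w).length := by
  simp [bitFn, dropSndFn_boolPair]

/-- `bitFn f g ∈ FP`. [folklore] -/
theorem bitFn_mem_FP (hf : f ∈ FP) (hg : g ∈ FP) : bitFn f g ∈ FP :=
  comp_mem_FP sndP_mem_FP (comp_mem_FP (dropSndFn_mem_FP X) (pairFn_mem_FP hf hg))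

/-- Bit test at a unary address: `{w | ((g w).drop |f w|).head? = some b} ∈ P`. [cite: AroraBarakCC2009, §1.3] -/
theorem setOf_bit_mem_P (hf : f ∈ FP) (hg : g ∈ FP) (b : Bool) :
    ({w | ((g w).drop (f w).length).head? = some b} : Language Bool) ∈ Classes.P := by
  have h : ({w | ((g w).drop (f w).length).head? = some b} : Language Bool) = bitFn f g ⁻¹' HeadIs b :=
    Set.ext fun w => by
      change ((g w).drop (f w).length).head? = some b ↔ bitFn f g w ∈ HeadIs b
      rw [bitFn_apply, mem_HeadIs]
  rw [h]
  exact preimage_mem_P (HeadIs_mem_P b) (bitFn_mem_FP hf hg)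

/-- Reading a suffix after a unary address: `sufFn f g w = (g w).drop (|f w| + 1)`. [folklore] -/
noncomputable def sufFn (f g : List Bool → List Bool) : List Bool → List Bool :=
  sndP ∘ dropSndFn (X + 1) ∘ pairFn f g

/-- `sufFn f g w = (g w).drop (|f w| + 1)`. [folklore] -/
@[simp] theorem sufFn_apply (f g : List Bool → List Bool) (w : List Bool) :
    sufFn f g w = (g w).drop ((f w).length + 1) := by
  simp [sufFn, dropSndFn_boolPair]

/-- `sufFn f g ∈ FP`. [folklore] -/
theorem sufFn_mem_FP (hf : f ∈ FP) (hg : g ∈ FP) : sufFn f g ∈ FP :=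
  comp_mem_FP sndP_mem_FP (comp_mem_FP (dropSndFn_mem_FP (X + 1)) (pairFn_mem_FP hf hg))

/-- Circuit-acceptance test between two computed strings: `{w | evalFn ⟨f w, g w⟩ = [1]} ∈ P`
(circuit evaluation is polynomial time, `CircEval.EvalLang_mem_P`). [cite: AroraBarakCC2009, Thm. 6.18] -/
theorem setOf_evalFn_mem_P (hf : f ∈ FP) (hg : g ∈ FP) :
    ({w | evalFn (boolPair (f w) (g w)) = [true]} : Language Bool) ∈ Classes.P := by
  have h : ({w | evalFn (boolPair (f w) (g w)) = [true]} : Language Bool) = pairFn f g ⁻¹' EvalLang :=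
    Set.ext fun w => by
      change evalFn (boolPair (f w) (g w)) = [true] ↔ evalFn (pairFn f g w) = [true]
      rw [pairFn_apply]
  rw [h]
  exact preimage_mem_P EvalLang_mem_P (pairFn_mem_FP hf hg)

/-- The padding map between two computed strings: `padFn₂ f g w = pad |f w| (g w)`
(`concatFn ∘ dropSndFn X ∘ ⟨g w, 0^{|f w|}⟩`). [cite: Kannan1982, Lemma 2] -/
noncomputable def padOf (f g : List Bool → List Bool) : List Bool → List Bool :=
  concatFn ∘ dropSndFn X ∘ pairFn g (zerosFn ∘ f)

/-- `padOf f g w = pad |f w| (g w)`. [folklore] -/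
@[simp] theorem padOf_apply (f g : List Bool → List Bool) (w : List Bool) :
    padOf f g w = pad (f w).length (g w) := by
  simp [padOf, dropSndFn_boolPair, pad, List.drop_replicate]

/-- `padOf f g ∈ FP`. [folklore] -/
theorem padOf_mem_FP (hf : f ∈ FP) (hg : g ∈ FP) : padOf f g ∈ FP :=
  comp_mem_FP concatFn_mem_FP (comp_mem_FP (dropSndFn_mem_FP X)
    (pairFn_mem_FP hg (comp_mem_FP zerosFn_mem_FP hf)))

/-- Implications of `P` languages are in `P`. [folklore] -/
theorem himp_mem_P {A B : Language Bool} (hA : A ∈ Classes.P) (hB : B ∈ Classes.P) :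
    ({w | w ∈ A → w ∈ B} : Language Bool) ∈ Classes.P := by
  have h : ({w | w ∈ A → w ∈ B} : Language Bool) = Aᶜ ⊔ B :=
    Set.ext fun w => show (w ∈ A → w ∈ B) ↔ (w ∉ A ∨ w ∈ B) by tauto
  rw [h]
  exact union_mem_P (compl_mem_P_iff.2 hA) hB

/-- Conjunctions of `P` languages are in `P`. [folklore] -/
theorem and_mem_P {A B : Language Bool} (hA : A ∈ Classes.P) (hB : B ∈ Classes.P) :
    ({w | w ∈ A ∧ w ∈ B} : Language Bool) ∈ Classes.P :=
  inter_mem_P hA hB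

/-- Negations of `P` languages are in `P`. [folklore] -/
theorem not_mem_P {A : Language Bool} (hA : A ∈ Classes.P) : ({w | ¬ w ∈ A} : Language Bool) ∈ Classes.P :=
  compl_mem_P_iff.2 hA

/-- Bi-implications of `P` languages are in `P`. [folklore] -/
theorem iff_mem_P {A B : Language Bool} (hA : A ∈ Classes.P) (hB : B ∈ Classes.P) :
    ({w | (w ∈ A ↔ w ∈ B)} : Language Bool) ∈ Classes.P := by
  have h : ({w | (w ∈ A ↔ w ∈ B)} : Language Bool) = {w | w ∈ A → w ∈ B} ⊓ {w | w ∈ B → w ∈ A} :=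
    Set.ext fun w => show (w ∈ A ↔ w ∈ B) ↔ (w ∈ A → w ∈ B) ∧ (w ∈ B → w ∈ A) from iff_iff_implies_and_implies
  rw [h]
  exact inter_mem_P (himp_mem_P hA hB) (himp_mem_P hB hA)

end Blocks

/-! ### Bits, values and the comparison witness -/

/-- Bit `l` of `T` is `1`, read through `drop`: `(T.drop l).head? = some 1 ↔ T[l] = 1`. [folklore] -/
theorem head?_drop_eq_some_true_iff (T : List Bool) (l : ℕ) :
    (T.drop l).head? = some true ↔ T.getD l false = true := by
  rw [List.head?_drop, List.getD_eq_getElem?_getD]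
  cases T[l]? with
  | none => simp
  | some b => simp

/-- Bit `l` of `T` is `0` (and exists), read through `drop`. [folklore] -/
theorem head?_drop_eq_some_false_iff (T : List Bool) (l : ℕ) :
    (T.drop l).head? = some false ↔ l < T.length ∧ T.getD l false = false := by
  rw [List.head?_drop, List.getD_eq_getElem?_getD]
  by_cases hl : l < T.length
  · rw [List.getElem?_eq_getElem hl]; simp [hl]
  · rw [List.getElem?_eq_none (by omega)]; simp [hl]

/-- **Comparison by a witness position** (little-endian, equal lengths): `bitsToNat v < bitsToNat w`
iff at some position `i` (the most significant difference) `v` has `0`, `w` has `1`, and the two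
strings agree above `i`. This turns Kannan's "`e(C) < e(C*)` (as binary integers)" into a
polynomial-time test given `i`. [cite: Kannan1982, Lemma 1 (proof, step (4))] -/
theorem bitsToNat_lt_iff : ∀ {v w : List Bool}, v.length = w.length →
    (bitsToNat v < bitsToNat w ↔
      ∃ i : ℕ, i < w.length ∧ v.getD i false = false ∧ w.getD i false = true ∧ v.drop (i + 1) = w.drop (i + 1))
  | [], [], _ => by simp
  | [], _ :: _, h => by simp at h
  | _ :: _, [], h => by simp at h
  | a :: v, b :: w, h => by
    simp only [List.length_cons, Nat.add_right_cancel_iff] at h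
    have ih := bitsToNat_lt_iff h
    have key : ∀ (a b : Bool) (p q : ℕ),
        (a.toNat + 2 * p < b.toNat + 2 * q ↔ p < q ∨ (p = q ∧ a = false ∧ b = true)) := by
      intro a b p q
      cases a <;> cases b <;> simp <;> omega
    have hvw : bitsToNat v = bitsToNat w ↔ v = w :=
      ⟨eq_of_bitsToNat_eq h, fun e => e ▸ rfl⟩
    have hval : bitsToNat (a :: v) < bitsToNat (b :: w) ↔
        bitsToNat v < bitsToNat w ∨ (v = w ∧ a = false ∧ b = true) := by
      rw [bitsToNat_cons, bitsToNat_cons, key, hvw]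
    rw [hval, ih]
    constructor
    · rintro (⟨i, hi, h1, h2, h3⟩ | ⟨rfl, rfl, rfl⟩)
      · exact ⟨i + 1, by simpa using hi, by simpa using h1, by simpa using h2, by simpa using h3⟩
      · exact ⟨0, by simp, by simp, by simp, by simp⟩
    · rintro ⟨i, hi, h1, h2, h3⟩
      cases i with
      | zero =>
        right
        simp at h1 h2 h3
        exact ⟨h3, h1, h2⟩
      | succ i =>
        left
        exact ⟨i, by simpa using hi, by simpa using h1, by simpa using h2, by simpa using h3⟩


/-! ### The matrix language

Inputs of the matrix are `w = ⟨⟨⟨⟨x, t⟩, v⟩, u⟩, z⟩` with `t = ⟨T, j⟩` (table and unary address of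
`x`), `v = ⟨D, T'⟩` (a description and a competitor table), `u = ⟨⟨y, j_y⟩, D'⟩` (a live input with
its unary address, and a description for the competitor), `z = ⟨⟨y', j_{y'}⟩, i⟩` (a live input with
its unary address, and a comparison position). -/

section Predicates

variable {p q : List Bool → Prop}

/-- Conjunction of polynomial-time predicates. [folklore] -/
theorem setOf_and_mem_P (hp : {w | p w} ∈ Classes.P) (hq : {w | q w} ∈ Classes.P) :
    ({w | p w ∧ q w} : Language Bool) ∈ Classes.P :=
  inter_mem_P hp hq

/-- Implication of polynomial-time predicates. [folklore] -/
theorem setOf_imp_mem_P (hp : {w | p w} ∈ Classes.P) (hq : {w | q w} ∈ Classes.P) :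
    ({w | p w → q w} : Language Bool) ∈ Classes.P :=
  himp_mem_P hp hq

/-- Bi-implication of polynomial-time predicates. [folklore] -/
theorem setOf_iff_mem_P (hp : {w | p w} ∈ Classes.P) (hq : {w | q w} ∈ Classes.P) :
    ({w | (p w ↔ q w)} : Language Bool) ∈ Classes.P :=
  iff_mem_P hp hq

/-- Negation of a polynomial-time predicate. [folklore] -/
theorem setOf_not_mem_P (hp : {w | p w} ∈ Classes.P) : ({w | ¬ p w} : Language Bool) ∈ Classes.P :=
  not_mem_P hp

end Predicates

section Accessors

/-- `x` of `⟨⟨⟨⟨x, t⟩, v⟩, u⟩, z⟩`. [folklore] -/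
def xA : List Bool → List Bool := fstP ∘ fstP ∘ fstP ∘ fstP
/-- `T = t.1` of `⟨⟨⟨⟨x, t⟩, v⟩, u⟩, z⟩`. [folklore] -/
def TA : List Bool → List Bool := fstP ∘ sndP ∘ fstP ∘ fstP ∘ fstP
/-- `j = t.2`. [folklore] -/
def jA : List Bool → List Bool := sndP ∘ sndP ∘ fstP ∘ fstP ∘ fstP
/-- `D = v.1`. [folklore] -/
def DA : List Bool → List Bool := fstP ∘ sndP ∘ fstP ∘ fstP
/-- `T' = v.2`. [folklore] -/
def TpA : List Bool → List Bool := sndP ∘ sndP ∘ fstP ∘ fstP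
/-- `y = u.1.1`. [folklore] -/
def yA : List Bool → List Bool := fstP ∘ fstP ∘ sndP ∘ fstP
/-- `j_y = u.1.2`. [folklore] -/
def jyA : List Bool → List Bool := sndP ∘ fstP ∘ sndP ∘ fstP
/-- `D' = u.2`. [folklore] -/
def DpA : List Bool → List Bool := sndP ∘ sndP ∘ fstP
/-- `y' = z.1.1`. [folklore] -/
def ypA : List Bool → List Bool := fstP ∘ fstP ∘ sndP
/-- `j_{y'} = z.1.2`. [folklore] -/
def jypA : List Bool → List Bool := sndP ∘ fstP ∘ sndP
/-- `i = z.2`. [folklore] -/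
def iA : List Bool → List Bool := sndP ∘ sndP

/-- `xA ∈ FP`. [folklore] -/
theorem xA_mem_FP : xA ∈ FP :=
  comp_mem_FP fstP_mem_FP (comp_mem_FP fstP_mem_FP (comp_mem_FP fstP_mem_FP fstP_mem_FP))
/-- `TA ∈ FP`. [folklore] -/
theorem TA_mem_FP : TA ∈ FP :=
  comp_mem_FP fstP_mem_FP (comp_mem_FP sndP_mem_FP
    (comp_mem_FP fstP_mem_FP (comp_mem_FP fstP_mem_FP fstP_mem_FP)))
/-- `jA ∈ FP`. [folklore] -/
theorem jA_mem_FP : jA ∈ FP :=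
  comp_mem_FP sndP_mem_FP (comp_mem_FP sndP_mem_FP
    (comp_mem_FP fstP_mem_FP (comp_mem_FP fstP_mem_FP fstP_mem_FP)))
/-- `DA ∈ FP`. [folklore] -/
theorem DA_mem_FP : DA ∈ FP :=
  comp_mem_FP fstP_mem_FP (comp_mem_FP sndP_mem_FP (comp_mem_FP fstP_mem_FP fstP_mem_FP))
/-- `TpA ∈ FP`. [folklore] -/
theorem TpA_mem_FP : TpA ∈ FP :=
  comp_mem_FP sndP_mem_FP (comp_mem_FP sndP_mem_FP (comp_mem_FP fstP_mem_FP fstP_mem_FP))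
/-- `yA ∈ FP`. [folklore] -/
theorem yA_mem_FP : yA ∈ FP :=
  comp_mem_FP fstP_mem_FP (comp_mem_FP fstP_mem_FP (comp_mem_FP sndP_mem_FP fstP_mem_FP))
/-- `jyA ∈ FP`. [folklore] -/
theorem jyA_mem_FP : jyA ∈ FP :=
  comp_mem_FP sndP_mem_FP (comp_mem_FP fstP_mem_FP (comp_mem_FP sndP_mem_FP fstP_mem_FP))
/-- `DpA ∈ FP`. [folklore] -/
theorem DpA_mem_FP : DpA ∈ FP :=
  comp_mem_FP sndP_mem_FP (comp_mem_FP sndP_mem_FP fstP_mem_FP)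
/-- `ypA ∈ FP`. [folklore] -/
theorem ypA_mem_FP : ypA ∈ FP :=
  comp_mem_FP fstP_mem_FP (comp_mem_FP fstP_mem_FP sndP_mem_FP)
/-- `jypA ∈ FP`. [folklore] -/
theorem jypA_mem_FP : jypA ∈ FP :=
  comp_mem_FP sndP_mem_FP (comp_mem_FP fstP_mem_FP sndP_mem_FP)
/-- `iA ∈ FP`. [folklore] -/
theorem iA_mem_FP : iA ∈ FP :=
  comp_mem_FP sndP_mem_FP sndP_mem_FP

variable (x t v u z : List Bool)

/-- `xA` reads `x`. [folklore] -/
@[simp] theorem xA_apply : xA (boolPair (boolPair (boolPair (boolPair x t) v) u) z) = x := by simp [xA]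
/-- `TA` reads `t.1`. [folklore] -/
@[simp] theorem TA_apply : TA (boolPair (boolPair (boolPair (boolPair x t) v) u) z) = fstP t := by simp [TA]
/-- `jA` reads `t.2`. [folklore] -/
@[simp] theorem jA_apply : jA (boolPair (boolPair (boolPair (boolPair x t) v) u) z) = sndP t := by simp [jA]
/-- `DA` reads `v.1`. [folklore] -/
@[simp] theorem DA_apply : DA (boolPair (boolPair (boolPair (boolPair x t) v) u) z) = fstP v := by simp [DA]
/-- `TpA` reads `v.2`. [folklore] -/
@[simp] theorem TpA_apply : TpA (boolPair (boolPair (boolPair (boolPair x t) v) u) z) = sndP v := by simp [TpA]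
/-- `yA` reads `u.1.1`. [folklore] -/
@[simp] theorem yA_apply : yA (boolPair (boolPair (boolPair (boolPair x t) v) u) z) = fstP (fstP u) := by
  simp [yA]
/-- `jyA` reads `u.1.2`. [folklore] -/
@[simp] theorem jyA_apply : jyA (boolPair (boolPair (boolPair (boolPair x t) v) u) z) = sndP (fstP u) := by
  simp [jyA]
/-- `DpA` reads `u.2`. [folklore] -/
@[simp] theorem DpA_apply : DpA (boolPair (boolPair (boolPair (boolPair x t) v) u) z) = sndP u := by simp [DpA]
/-- `ypA` reads `z.1.1`. [folklore] -/
@[simp] theorem ypA_apply : ypA (boolPair (boolPair (boolPair (boolPair x t) v) u) z) = fstP (fstP z) := by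
  simp [ypA]
/-- `jypA` reads `z.1.2`. [folklore] -/
@[simp] theorem jypA_apply : jypA (boolPair (boolPair (boolPair (boolPair x t) v) u) z) = sndP (fstP z) := by
  simp [jypA]
/-- `iA` reads `z.2`. [folklore] -/
@[simp] theorem iA_apply : iA (boolPair (boolPair (boolPair (boolPair x t) v) u) z) = sndP z := by simp [iA]

end Accessors

/-- **The matrix of Kannan's `Σ₄` sentence** as a predicate of the eleven components (input `x`;
table `T` with the unary address `j` of `x`; description `D` and competitor table `T'`; live input
`y` with unary address `j_y` and competitor description `D'`; live input `y'` with unary address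
`j_{y'}` and comparison position `i`), at budget `m = n^{2k+2}`, `n = |x|`:
(1) `|T| = m + 1`; (2) `|j| = bitsToNat x`; (3) `T[|j|] = 1` ("`C*` accepts `x`", step (7));
(4) hardness clause (steps (2)–(3)): if `|D| ≤ m` then `y` is live (`|y| ≤ n`, `|j_y| = bitsToNat y ≤ m`)
and the circuit described by `D` disagrees with `T[bitsToNat y]` on `y 0^{n-|y|}`;
(5) minimality clause (steps (4)–(6)): if `|T'| = m + 1` and position `|i|` witnesses
`bitsToNat T' < bitsToNat T` then `|D'| ≤ m` and the circuit described by `D'` agrees with `T'` on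
every live `y'`. [cite: Kannan1982, Lemma 1 (proof, steps (1)–(7))] -/
def MatrixPred (k : ℕ) (x T j D Tp y jy Dp yp jyp i : List Bool) : Prop :=
  T.length = bound k x.length + 1 ∧
  j.length = bitsToNat x ∧
  (T.drop j.length).head? = some true ∧
  (D.length ≤ bound k x.length →
    y.length ≤ x.length ∧ jy.length = bitsToNat y ∧ jy.length ≤ bound k x.length ∧
      ¬ (evalFn (boolPair (pad x.length y) D) = [true] ↔ (T.drop jy.length).head? = some true)) ∧
  ((Tp.length = bound k x.length + 1 ∧ (Tp.drop i.length).head? = some false ∧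
      (T.drop i.length).head? = some true ∧ Tp.drop (i.length + 1) = T.drop (i.length + 1)) →
    Dp.length ≤ bound k x.length ∧
      ((yp.length ≤ x.length ∧ jyp.length = bitsToNat yp ∧ jyp.length ≤ bound k x.length) →
        (evalFn (boolPair (pad x.length yp) Dp) = [true] ↔ (Tp.drop jyp.length).head? = some true)))

/-- **The matrix language** `A₀ = {w | MatrixPred (components of w)}`. [cite: Kannan1982, Lemma 1 (proof)] -/
def A0 (k : ℕ) : Language Bool :=
  {w | MatrixPred k (xA w) (TA w) (jA w) (DA w) (TpA w) (yA w) (jyA w) (DpA w) (ypA w) (jypA w) (iA w)}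

/-- Membership in `A₀` (definitional). [folklore] -/
theorem mem_A0_iff (k : ℕ) (w : List Bool) :
    w ∈ A0 k ↔ MatrixPred k (xA w) (TA w) (jA w) (DA w) (TpA w) (yA w) (jyA w) (DpA w) (ypA w) (jypA w) (iA w) :=
  Iff.rfl

section MatrixInP

variable {f g h : List Bool → List Bool}

/-- Atom: `|g w| = m(|f w|) + 1`. [folklore] -/
theorem atom_length_eq_bound_succ (k : ℕ) (hf : f ∈ FP) (hg : g ∈ FP) :
    ({w | (g w).length = bound k (f w).length + 1} : Language Bool) ∈ Classes.P := by
  have e : ({w | (g w).length = bound k (f w).length + 1} : Language Bool) =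
      {w | (g w).length = (X ^ (2 * k + 2) + 1 : Polynomial ℕ).eval (f w).length} :=
    Set.ext fun w => by simp [bound]
  rw [e]
  exact setOf_length_eq_mem_P hf hg (X ^ (2 * k + 2) + 1)

/-- Atom: `|g w| ≤ m(|f w|)`. [folklore] -/
theorem atom_length_le_bound (k : ℕ) (hf : f ∈ FP) (hg : g ∈ FP) :
    ({w | (g w).length ≤ bound k (f w).length} : Language Bool) ∈ Classes.P := by
  have e : ({w | (g w).length ≤ bound k (f w).length} : Language Bool) =
      {w | (g w).length ≤ (X ^ (2 * k + 2) : Polynomial ℕ).eval (f w).length} :=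
    Set.ext fun w => by simp [bound]
  rw [e]
  exact setOf_length_le_mem_P hf hg (X ^ (2 * k + 2))

/-- Atom: `|g w| ≤ |f w|`. [folklore] -/
theorem atom_length_le (hf : f ∈ FP) (hg : g ∈ FP) :
    ({w | (g w).length ≤ (f w).length} : Language Bool) ∈ Classes.P := by
  have e : ({w | (g w).length ≤ (f w).length} : Language Bool) =
      {w | (g w).length ≤ (X : Polynomial ℕ).eval (f w).length} :=
    Set.ext fun w => by simp
  rw [e]
  exact setOf_length_le_mem_P hf hg X

/-- Atom: the circuit described by `h w` accepts `pad |f w| (g w)`. [cite: AroraBarakCC2009, Thm. 6.18] -/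
theorem atom_evalFn_pad (hf : f ∈ FP) (hg : g ∈ FP) (hh : h ∈ FP) :
    ({w | evalFn (boolPair (pad (f w).length (g w)) (h w)) = [true]} : Language Bool) ∈ Classes.P := by
  have e : ({w | evalFn (boolPair (pad (f w).length (g w)) (h w)) = [true]} : Language Bool) =
      {w | evalFn (boolPair (padOf f g w) (h w)) = [true]} :=
    Set.ext fun w => by rw [Set.mem_setOf_eq, Set.mem_setOf_eq, padOf_apply]
  rw [e]
  exact setOf_evalFn_mem_P (padOf_mem_FP hf hg) hh

/-- Atom: `g w` and `h w` agree above position `|f w|`. [folklore] -/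
theorem atom_drop_succ_eq (hf : f ∈ FP) (hg : g ∈ FP) (hh : h ∈ FP) :
    ({w | (g w).drop ((f w).length + 1) = (h w).drop ((f w).length + 1)} : Language Bool) ∈ Classes.P := by
  have e : ({w | (g w).drop ((f w).length + 1) = (h w).drop ((f w).length + 1)} : Language Bool) =
      {w | sufFn f g w = sufFn f h w} :=
    Set.ext fun w => by rw [Set.mem_setOf_eq, Set.mem_setOf_eq, sufFn_apply, sufFn_apply]
  rw [e]
  exact setOf_apply_eq_apply_mem_P (sufFn_mem_FP hf hg) (sufFn_mem_FP hf hh)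

/-- **The matrix is polynomial time: `A₀ ∈ P`.** Every atom is a polynomial-time test on projected
components (lengths against polynomials, unary-versus-binary thresholds, bits at unary addresses,
suffix equality, circuit evaluation — "given the encoding of a circuit and an input to the circuit
we can, in polynomial-time, find the action of the circuit on the input", Kannan p. 44), and `P` is
closed under the Boolean connectives. [cite: Kannan1982, Lemma 1 (proof: "Thus L_k is in Σ₄")] -/
theorem A0_mem_P (k : ℕ) : A0 k ∈ Classes.P := by
  unfold A0 MatrixPred
  refine setOf_and_mem_P (atom_length_eq_bound_succ k xA_mem_FP TA_mem_FP) ?_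
  refine setOf_and_mem_P (setOf_length_eq_bitsToNat_mem_P jA_mem_FP xA_mem_FP) ?_
  refine setOf_and_mem_P (setOf_bit_mem_P jA_mem_FP TA_mem_FP true) ?_
  refine setOf_and_mem_P ?_ ?_
  · refine setOf_imp_mem_P (atom_length_le_bound k xA_mem_FP DA_mem_FP) ?_
    refine setOf_and_mem_P (atom_length_le xA_mem_FP yA_mem_FP) ?_
    refine setOf_and_mem_P (setOf_length_eq_bitsToNat_mem_P jyA_mem_FP yA_mem_FP) ?_
    refine setOf_and_mem_P (atom_length_le_bound k xA_mem_FP jyA_mem_FP) ?_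
    exact setOf_not_mem_P (setOf_iff_mem_P (atom_evalFn_pad xA_mem_FP yA_mem_FP DA_mem_FP)
      (setOf_bit_mem_P jyA_mem_FP TA_mem_FP true))
  · refine setOf_imp_mem_P ?_ ?_
    · refine setOf_and_mem_P (atom_length_eq_bound_succ k xA_mem_FP TpA_mem_FP) ?_
      refine setOf_and_mem_P (setOf_bit_mem_P iA_mem_FP TpA_mem_FP false) ?_
      exact setOf_and_mem_P (setOf_bit_mem_P iA_mem_FP TA_mem_FP true)
        (atom_drop_succ_eq iA_mem_FP TpA_mem_FP TA_mem_FP)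
    · refine setOf_and_mem_P (atom_length_le_bound k xA_mem_FP DpA_mem_FP) ?_
      refine setOf_imp_mem_P ?_ ?_
      · refine setOf_and_mem_P (atom_length_le xA_mem_FP ypA_mem_FP) ?_
        exact setOf_and_mem_P (setOf_length_eq_bitsToNat_mem_P jypA_mem_FP ypA_mem_FP)
          (atom_length_le_bound k xA_mem_FP jypA_mem_FP)
      · exact setOf_iff_mem_P (atom_evalFn_pad xA_mem_FP ypA_mem_FP DpA_mem_FP)
          (setOf_bit_mem_P jypA_mem_FP TpA_mem_FP true)

end MatrixInP


/-! ### The quantifier prefix `∃ ∀ ∃ ∀` and membership in `Σ₄ᵖ` -/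

/-- Witness bound of the innermost block `z = ⟨⟨y', j_{y'}⟩, i⟩`: `3 N^{2k+2} + 4 N + 6`. [folklore] -/
noncomputable def p4 (k : ℕ) : Polynomial ℕ := 3 * X ^ (2 * k + 2) + 4 * X + 6
/-- Witness bound of the block `u = ⟨⟨y, j_y⟩, D'⟩`: `3 N^{2k+2} + 4 N + 6`. [folklore] -/
noncomputable def p3 (k : ℕ) : Polynomial ℕ := 3 * X ^ (2 * k + 2) + 4 * X + 6
/-- Witness bound of the block `v = ⟨D, T'⟩`: `3 N^{2k+2} + 3`. [folklore] -/
noncomputable def p2 (k : ℕ) : Polynomial ℕ := 3 * X ^ (2 * k + 2) + 3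
/-- Witness bound of the outermost block `t = ⟨T, j⟩`: `3 n^{2k+2} + 4`. [folklore] -/
noncomputable def p1 (k : ℕ) : Polynomial ℕ := 3 * X ^ (2 * k + 2) + 4

/-- Value of `p4`. [folklore] -/
@[simp] theorem p4_eval (k N : ℕ) : (p4 k).eval N = 3 * N ^ (2 * k + 2) + 4 * N + 6 := by
  simp [p4]
/-- Value of `p3`. [folklore] -/
@[simp] theorem p3_eval (k N : ℕ) : (p3 k).eval N = 3 * N ^ (2 * k + 2) + 4 * N + 6 := by
  simp [p3]
/-- Value of `p2`. [folklore] -/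
@[simp] theorem p2_eval (k N : ℕ) : (p2 k).eval N = 3 * N ^ (2 * k + 2) + 3 := by
  simp [p2]
/-- Value of `p1`. [folklore] -/
@[simp] theorem p1_eval (k N : ℕ) : (p1 k).eval N = 3 * N ^ (2 * k + 2) + 4 := by
  simp [p1]

/-- Level 1: `A₁ = {s | ∀ z, |z| ≤ p₄|s| → ⟨s, z⟩ ∈ A₀}`. [cite: Kannan1982, Lemma 1 (proof)] -/
def A1 (k : ℕ) : Language Bool :=
  {s | ∀ z : List Bool, z.length ≤ (p4 k).eval s.length → boolPair s z ∈ A0 k}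

/-- Level 2: `A₂ = {s | ∃ u, |u| ≤ p₃|s| ∧ ⟨s, u⟩ ∈ A₁}`. [cite: Kannan1982, Lemma 1 (proof)] -/
def A2 (k : ℕ) : Language Bool :=
  {s | ∃ u : List Bool, u.length ≤ (p3 k).eval s.length ∧ boolPair s u ∈ A1 k}

/-- Level 3: `A₃ = {s | ∀ v, |v| ≤ p₂|s| → ⟨s, v⟩ ∈ A₂}`. [cite: Kannan1982, Lemma 1 (proof)] -/
def A3 (k : ℕ) : Language Bool :=
  {s | ∀ v : List Bool, v.length ≤ (p2 k).eval s.length → boolPair s v ∈ A2 k}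

/-- Level 4: `A₄ = {x | ∃ t, |t| ≤ p₁|x| ∧ ⟨x, t⟩ ∈ A₃}` — Kannan's `Σ₄` sentence. [cite: Kannan1982, Lemma 1 (proof)] -/
def A4 (k : ℕ) : Language Bool :=
  {x | ∃ t : List Bool, t.length ≤ (p1 k).eval x.length ∧ boolPair x t ∈ A3 k}

/-- `A₁ ∈ Π₁ᵖ` (`Π₁ = ∀ᵖ·P`). [cite: AroraBarakCC2009, Def. 5.3] -/
theorem A1_mem_PiP_one (k : ℕ) : A1 k ∈ PiP 1 := by
  change A1 k ∈ polyForall (SigmaP 0)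
  exact mem_polyForall_iff.2 ⟨A0 k, A0_mem_P k, p4 k, fun s => Iff.rfl⟩

/-- `A₂ ∈ Σ₂ᵖ` (`Σ₂ = ∃ᵖ·Π₁`). [cite: AroraBarakCC2009, Def. 5.3] -/
theorem A2_mem_SigmaP_two (k : ℕ) : A2 k ∈ SigmaP 2 := by
  change A2 k ∈ polyExists (PiP 1)
  exact ⟨A1 k, A1_mem_PiP_one k, p3 k, fun s => Iff.rfl⟩

/-- `A₃ ∈ Π₃ᵖ` (`Π₃ = ∀ᵖ·Σ₂`). [cite: AroraBarakCC2009, Def. 5.3] -/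
theorem A3_mem_PiP_three (k : ℕ) : A3 k ∈ PiP 3 := by
  change A3 k ∈ polyForall (SigmaP 2)
  exact mem_polyForall_iff.2 ⟨A2 k, A2_mem_SigmaP_two k, p2 k, fun s => Iff.rfl⟩

/-- **`A₄ ∈ Σ₄ᵖ`** (`Σ₄ = ∃ᵖ·Π₃`): "`M` has at most 3 alternations and is a `Σ₄` machine".
[cite: Kannan1982, Lemma 1 (proof: "Thus L_k is in Σ₄")] -/
theorem A4_mem_SigmaP_four (k : ℕ) : A4 k ∈ SigmaP 4 := by
  change A4 k ∈ polyExists (PiP 3)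
  exact ⟨A3 k, A3_mem_PiP_three k, p1 k, fun s => Iff.rfl⟩

/-! ### The sentence defines `L_k` -/

section Semantics

/-- `decide P ≠ b` says that `P` and `b = 1` disagree. [folklore] -/
theorem decide_ne_iff_not_iff {Q : Prop} [Decidable Q] {b : Bool} : decide Q ≠ b ↔ ¬ (Q ↔ b = true) := by
  by_cases hQ : Q <;> cases b <;> simp [hQ]

/-- `decide P = b` says that `P` and `b = 1` agree. [folklore] -/
theorem iff_of_decide_eq {Q : Prop} [Decidable Q] {b : Bool} (h : decide Q = b) : Q ↔ b = true := by
  by_cases hQ : Q <;> cases b <;> simp_all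

/-- A true entry lies inside the table. [folklore] -/
theorem lt_length_of_getD_eq_true {T : List Bool} {l : ℕ} (h : T.getD l false = true) : l < T.length := by
  by_contra hc
  rw [List.getD_eq_getElem?_getD, List.getElem?_eq_none (by omega)] at h
  exact Bool.false_ne_true h

/-- The matrix on a fully paired input, in terms of the components. [folklore] -/
theorem boolPair_mem_A0_iff (k : ℕ) (x t v u z : List Bool) :
    boolPair (boolPair (boolPair (boolPair x t) v) u) z ∈ A0 k ↔
      MatrixPred k x (fstP t) (sndP t) (fstP v) (sndP v) (fstP (fstP u)) (sndP (fstP u)) (sndP u)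
        (fstP (fstP z)) (sndP (fstP z)) (sndP z) := by
  rw [mem_A0_iff]
  simp only [xA_apply, TA_apply, jA_apply, DA_apply, TpA_apply, yA_apply, jyA_apply, DpA_apply,
    ypA_apply, jypA_apply, iA_apply]

variable (k : ℕ)

/-- **Completeness**: `L_k ⊆ A₄`. Given the least hard table `T` with `T[bitsToNat x] = 1`, guess
`t = ⟨T, 1^{bitsToNat x}⟩`; against `v = ⟨D, T'⟩` answer `u = ⟨⟨y, 1^{bitsToNat y}⟩, D'⟩` with the
disagreement input `y` for `D` (hardness of `T`) and, when `T'` is a smaller table of the right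
length, a description `D'` matching `T'` on all live inputs (minimality of `T`: `T'` is not hard).
[cite: Kannan1982, Lemma 1 (proof)] -/
theorem lang_subset_A4 {x : List Bool} (hxL : x ∈ lang k) : x ∈ A4 k := by
  obtain ⟨T, hT, hx⟩ := hxL
  have hb : bound k x.length = x.length ^ (2 * k + 2) := rfl
  have hTlen : T.length = bound k x.length + 1 := hT.1.1
  have hvx : bitsToNat x ≤ bound k x.length := by
    have := lt_length_of_getD_eq_true hx; omega
  refine ⟨boolPair T (List.replicate (bitsToNat x) true), ?_, ?_⟩
  · simp only [length_boolPair, List.length_replicate, p1_eval, hTlen]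
    omega
  intro v _
  set D := fstP v with hD
  set Tp := sndP v with hTp
  -- the disagreement input for `D`
  obtain ⟨y, hyimp, hylen, hyval⟩ : ∃ y : List Bool,
      (D.length ≤ bound k x.length → descAccepts D (pad x.length y) ≠ T.getD (bitsToNat y) false) ∧
        y.length ≤ x.length ∧ bitsToNat y ≤ bound k x.length := by
    by_cases hDm : D.length ≤ bound k x.length
    · obtain ⟨y, hy, hvy, hne⟩ := hT.1.2 D hDm
      exact ⟨y, fun _ => hne, hy, hvy⟩
    · exact ⟨[], fun h => absurd h hDm, by simp, by simp⟩
  -- the matching description for a smaller competitor `T'`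
  obtain ⟨Dp, hDpimp, hDplen⟩ : ∃ Dp : List Bool,
      ((Tp.length = bound k x.length + 1 ∧ bitsToNat Tp < bitsToNat T) → ∀ y' : List Bool, y'.length ≤ x.length →
        bitsToNat y' ≤ bound k x.length → descAccepts Dp (pad x.length y') = Tp.getD (bitsToNat y') false) ∧
        Dp.length ≤ bound k x.length := by
    by_cases hc : Tp.length = bound k x.length + 1 ∧ bitsToNat Tp < bitsToNat T
    · have hnh : ¬ IsHard k x.length Tp := hT.2 Tp hc.1 hc.2
      simp only [IsHard, hc.1, true_and, not_forall, not_exists, exists_prop, not_and, ne_eq,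
        not_not] at hnh
      obtain ⟨Dp, hDp, hagree⟩ := hnh
      exact ⟨Dp, fun _ => hagree, hDp⟩
    · exact ⟨[], fun h => absurd h hc, by simp⟩
  refine ⟨boolPair (boolPair y (List.replicate (bitsToNat y) true)) Dp, ?_, ?_⟩
  · -- `|u| ≤ p₃(|⟨⟨x, t⟩, v⟩|)`
    have hN : x.length ≤ (boolPair (boolPair x (boolPair T (List.replicate (bitsToNat x) true))) v).length := by
      simp only [length_boolPair]; omega
    have hpow : bound k x.length ≤ (boolPair (boolPair x (boolPair T (List.replicate (bitsToNat x) true))) v).length ^ (2 * k + 2) :=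
      Nat.pow_le_pow_left hN _
    simp only [length_boolPair, List.length_replicate, p3_eval]
    generalize (boolPair (boolPair x (boolPair T (List.replicate (bitsToNat x) true))) v).length = N at hN hpow ⊢
    omega
  intro z _
  rw [boolPair_mem_A0_iff]
  simp only [fstP_boolPair, sndP_boolPair]
  refine ⟨hTlen, by simp, ?_, ?_, ?_⟩
  · -- `T[bitsToNat x] = 1`
    rw [List.length_replicate, head?_drop_eq_some_true_iff]
    exact hx
  · -- hardness clause
    intro hDm
    refine ⟨hylen, by simp, by simpa using hyval, ?_⟩
    rw [List.length_replicate, head?_drop_eq_some_true_iff, ← decide_ne_iff_not_iff]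
    exact hyimp hDm
  · -- minimality clause
    rintro ⟨hTpl, hbF, hbT, hdrop⟩
    have hlt : bitsToNat Tp < bitsToNat T := by
      rw [bitsToNat_lt_iff (hTpl.trans hTlen.symm)]
      rw [head?_drop_eq_some_false_iff] at hbF
      rw [head?_drop_eq_some_true_iff] at hbT
      exact ⟨(sndP z).length, lt_length_of_getD_eq_true hbT, hbF.2, hbT, hdrop⟩
    refine ⟨hDplen, ?_⟩
    rintro ⟨hypl, hjyp, hjypm⟩
    have hagree := hDpimp ⟨hTpl, hlt⟩ (fstP (fstP z)) hypl (by rw [← hjyp]; exact hjypm)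
    rw [hjyp, head?_drop_eq_some_true_iff]
    exact iff_of_decide_eq hagree

/-- **Soundness**: `A₄ ⊆ L_k`. If `t = ⟨T, j⟩` survives all challenges then `T` is the least hard
table and `T[bitsToNat x] = 1`: the trivial challenge gives (1)–(3); the challenge `v = ⟨D, ε⟩` gives
the disagreement input for `D` (hardness); for a smaller hard competitor `T'` of the right length,
the challenge `v = ⟨ε, T'⟩` yields `D'` which — challenged with the witness position of
`bitsToNat T' < bitsToNat T` and the disagreement input of `T'` against `D'` — both agrees and
disagrees with `T'`. [cite: Kannan1982, Lemma 1 (proof)] -/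
theorem A4_subset_lang {x : List Bool} (hxA : x ∈ A4 k) : x ∈ lang k := by
  obtain ⟨t, ht, h3⟩ := hxA
  have hb : bound k x.length = x.length ^ (2 * k + 2) := rfl
  set T := fstP t with hTdef
  set j := sndP t with hjdef
  -- instantiating the `∀ v ∃ u ∀ z` prefix
  have inst : ∀ v : List Bool, v.length ≤ 3 * bound k x.length + 3 →
      ∃ u : List Bool, ∀ z : List Bool, z.length ≤ 3 * bound k x.length + 4 * x.length + 6 →
        MatrixPred k x T j (fstP v) (sndP v) (fstP (fstP u)) (sndP (fstP u)) (sndP u)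
          (fstP (fstP z)) (sndP (fstP z)) (sndP z) := by
    intro v hv
    have hN₁ : x.length ≤ (boolPair x t).length := by simp only [length_boolPair]; omega
    have hv' : v.length ≤ (p2 k).eval (boolPair x t).length := by
      have := Nat.pow_le_pow_left hN₁ (2 * k + 2)
      rw [p2_eval]; omega
    obtain ⟨u, -, hu⟩ := h3 v hv'
    refine ⟨u, fun z hz => ?_⟩
    have hN₃ : x.length ≤ (boolPair (boolPair (boolPair x t) v) u).length := by
      simp only [length_boolPair]; omega
    have hz' : z.length ≤ (p4 k).eval (boolPair (boolPair (boolPair x t) v) u).length := by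
      have := Nat.pow_le_pow_left hN₃ (2 * k + 2)
      rw [p4_eval]; omega
    have := hu z hz'
    rwa [boolPair_mem_A0_iff] at this
  -- (1)–(3) from the trivial challenge
  obtain ⟨u₀, hu₀⟩ := inst (boolPair [] []) (by simp)
  obtain ⟨hTlen, hj, hbit, -, -⟩ := hu₀ (boolPair (boolPair [] []) []) (by simp)
  rw [head?_drop_eq_some_true_iff, hj] at hbit
  refine ⟨T, ⟨⟨hTlen, ?_⟩, ?_⟩, hbit⟩
  · -- hardness of `T`
    intro D hD
    obtain ⟨u, hu⟩ := inst (boolPair D []) (by simp only [length_boolPair, List.length_nil]; omega)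
    obtain ⟨-, -, -, h4, -⟩ := hu (boolPair (boolPair [] []) []) (by simp)
    simp only [fstP_boolPair] at h4
    obtain ⟨hy, hjy, hjym, hne⟩ := h4 hD
    refine ⟨fstP (fstP u), hy, by rw [← hjy]; exact hjym, ?_⟩
    rw [hjy, head?_drop_eq_some_true_iff, ← decide_ne_iff_not_iff] at hne
    exact hne
  · -- minimality of `T`
    intro Tp hTp hlt hHard
    obtain ⟨i, hi, hbF, hbT, hdrop⟩ := (bitsToNat_lt_iff (hTp.trans hTlen.symm)).1 hlt
    obtain ⟨u, hu⟩ := inst (boolPair [] Tp) (by simp only [length_boolPair, List.length_nil, hTp]; omega)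
    have hW : Tp.length = bound k x.length + 1 ∧ (Tp.drop i).head? = some false ∧
        (T.drop i).head? = some true ∧ Tp.drop (i + 1) = T.drop (i + 1) := by
      rw [head?_drop_eq_some_false_iff, head?_drop_eq_some_true_iff]
      exact ⟨hTp, ⟨by omega, hbF⟩, hbT, hdrop⟩
    -- first challenge: the budget of `D'`
    obtain ⟨-, -, -, -, h5⟩ := hu (boolPair (boolPair [] []) (List.replicate i true))
      (by simp only [length_boolPair, List.length_nil, List.length_replicate]; omega)
    simp only [fstP_boolPair, sndP_boolPair, List.length_replicate] at h5
    obtain ⟨hDp, -⟩ := h5 hW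
    -- second challenge: the disagreement input of the hard competitor against `D'`
    obtain ⟨y', hy', hvy', hne⟩ := hHard.2 (sndP u) hDp
    obtain ⟨-, -, -, -, h5'⟩ :=
      hu (boolPair (boolPair y' (List.replicate (bitsToNat y') true)) (List.replicate i true))
        (by simp only [length_boolPair, List.length_replicate]; omega)
    simp only [fstP_boolPair, sndP_boolPair, List.length_replicate] at h5'
    obtain ⟨-, hagree⟩ := h5' hW
    have hagree' := hagree ⟨hy', trivial, hvy'⟩
    rw [head?_drop_eq_some_true_iff] at hagree'
    exact (decide_ne_iff_not_iff.1 hne) hagree'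

/-- **Kannan's `Σ₄` sentence defines `L_k`**: `L_k = A₄`. [cite: Kannan1982, Lemma 1 (proof)] -/
theorem lang_eq_A4 : lang k = A4 k :=
  Set.ext fun _ => ⟨lang_subset_A4 k, A4_subset_lang k⟩

end Semantics

/-! ### Conclusions -/

/-- **`L_k ∈ Σ₄ᵖ`** (Kannan 1982, Lemma 1, membership half: "Thus `L_k` is in `Σ₄`").
[cite: Kannan1982, Lemma 1] -/
theorem lang_mem_SigmaP_four (k : ℕ) : lang k ∈ SigmaP 4 := by
  rw [lang_eq_A4]
  exact A4_mem_SigmaP_four k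

/-- **The `Σ₄ᵖ` half of Kannan's Lemma 1**: for every `k` there is a language in `Σ₄ᵖ` outside
`⋃_c SIZE(c·n^k + c)` — namely `L_k` (`lang_mem_SigmaP_four`, `lang_not_mem_iUnion_SIZE`). This is
the hypothesis `h₄` of `Literature.Computability.Complexity.kannan_of_karp_lipton` (`StructuralPHProofs.lean`), so Kannan's
Theorem 2 (`Literature.Computability.Complexity.kannan`) now rests on the Karp–Lipton theorem alone.
[cite: Kannan1982, Lemma 1] -/
theorem exists_mem_SigmaP_four_not_mem_SIZE (k : ℕ) :
    ∃ L ∈ SigmaP 4, L ∉ ⋃ c : ℕ, SIZE (fun n => c * n ^ k + c) :=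
  ⟨lang k, lang_mem_SigmaP_four k, lang_not_mem_iUnion_SIZE k⟩


end Kannan

end Literature.Computability.Complexity
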